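import Literature.Geometry.Riemannian.ConstantCurvatureRicci
import Literature.Geometry.Riemannian.HyperbolicBallCompactification
import Literature.Geometry.Riemannian.RoundSphere
import Literature.Geometry.Riemannian.RiemannianDistance
import Literature.Geometry.Lorentzian.Hypersurface
import Literature.Geometry.Lorentzian.IsometryProofs
import Literature.Topology.FourManifolds.ClosedBallTangent
import Literature.Topology.FourManifolds.ClosedBallSmoothEmbeddings
import Literature.Topology.FourManifolds.InteriorSmoothEmbedding
import Literature.Topology.FourManifolds.ImmersionCriterion
import Literature.Geometry.Manifold.OpenSubmanifoldMFDeriv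

/-!
# Crux `PEFillNearRound` (stmt-SmoothPoincare4-7997), line `Sketch`, helper piece `helper_rf_unitNormal` of
# `helper_roundFilled` (the round `S⁴` bounds hyperbolic `5`-space = route item
# `EinsteinBulk.RoundSphereBoundsHyperbolicSpace`, the base point of `stub_peFillStandard`)

Boundary normalisation `|dρ|_ḡ = 1` of the defining function `ρ = (1-‖x‖²)/2` on `∂𝔻⁵ = 𝕊⁴` for the Euclidean compactified metric: the `ḡ`-gradient of `ρ` at a boundary point `y` is the inward unit vector `-y`.
-/

noncomputable section

-- the prescribed namespace `Summit.<P>.<Sub>.…` duplicates `SmoothPoincare4` (P = Sub)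
set_option linter.dupNamespace false

open scoped Manifold ContDiff Topology RealInnerProductSpace
open Set Function Metric Bundle TopologicalSpace
open Literature.Geometry.Lorentzian Literature.Geometry.Lorentzian.PseudoRiemannianMetric
open Literature.Geometry.Riemannian Literature.Topology.FourManifolds
open Literature.Geometry.Manifold

namespace Summit.SmoothPoincare4.SmoothPoincare4.Cruxes.PEFillNearRound.RoundFilled

/-- **`|dρ|_ḡ = 1` on the boundary sphere** (Li–Qing–Shi 2017, Def. 2.1: asymptotically hyperbolic normalisation): at `ι y` the vector `ν = (dι)⁻¹(-y)` is a `ḡ`-unit vector with `ḡ(ν, ·) = dρ`. -/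
theorem helper_rf_unitNormal :
    ∀ gb : Bundle.ContMDiffRiemannianMetric (𝓡∂ 5) 2 (EuclideanSpace ℝ (Fin 5)) (TangentSpace (𝓡∂ 5) : ↥(Metric.closedBall (0 : EuclideanSpace ℝ (Fin 5)) 1) → Type _), (∀ (p : ↥(Metric.closedBall (0 : EuclideanSpace ℝ (Fin 5)) 1)) (a b : TangentSpace (𝓡∂ 5) p), gb.inner p a b = inner ℝ (Literature.Topology.FourManifolds.closedBallCoeDeriv p a) (Literature.Topology.FourManifolds.closedBallCoeDeriv p b)) → ∀ y : ↥(Metric.sphere (0 : EuclideanSpace ℝ (Fin 5)) 1), ∃ ν : TangentSpace (𝓡∂ 5) ((Set.inclusion (Metric.sphere_subset_closedBall : (Metric.sphere (0 : EuclideanSpace ℝ (Fin 5)) 1) ⊆ (Metric.closedBall (0 : EuclideanSpace ℝ (Fin 5)) 1))) y), gb.inner ((Set.inclusion (Metric.sphere_subset_closedBall : (Metric.sphere (0 : EuclideanSpace ℝ (Fin 5)) 1) ⊆ (Metric.closedBall (0 : EuclideanSpace ℝ (Fin 5)) 1))) y) ν ν = 1 ∧ ∀ v : TangentSpace (𝓡∂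 5) ((Set.inclusion (Metric.sphere_subset_closedBall : (Metric.sphere (0 : EuclideanSpace ℝ (Fin 5)) 1) ⊆ (Metric.closedBall (0 : EuclideanSpace ℝ (Fin 5)) 1))) y), gb.inner ((Set.inclusion (Metric.sphere_subset_closedBall : (Metric.sphere (0 : EuclideanSpace ℝ (Fin 5)) 1) ⊆ (Metric.closedBall (0 : EuclideanSpace ℝ (Fin 5)) 1))) y) ν v = mfderiv (𝓡∂ 5) 𝓘(ℝ, ℝ) (fun x : ↥(Metric.closedBall (0 : EuclideanSpace ℝ (Fin 5)) 1) => Literature.Geometry.Riemannian.Hyperboloid.ballDefFn (x : (EuclideanSpace ℝ (Fin 5)))) ((Set.inclusion (Metric.sphere_subset_closedBall : (Metric.sphere (0 : EuclideanSpace ℝ (Fin 5)) 1) ⊆ (Metric.closedBall (0 : EuclideanSpace ℝ (Fin 5)) 1))) y) v := by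
  intro gb hgb y
  -- the boundary point read in the closed ball, `(ι y : ℝ⁵) = y` definitionally
  have hy1 : ‖(y : EuclideanSpace ℝ (Fin 5))‖ = 1 := norm_eq_of_mem_sphere y
  -- the witness: the inward radial vector `-y`, pulled back through `dι`
  refine ⟨(closedBallCoeDeriv (Set.inclusion Metric.sphere_subset_closedBall y)).symm
    (-(y : EuclideanSpace ℝ (Fin 5))), ?_, ?_⟩
  · rw [hgb]
    rw [ContinuousLinearEquiv.apply_symm_apply, inner_neg_neg, real_inner_self_eq_norm_sq, hy1,
      one_pow]
  · intro v
    rw [hgb, ContinuousLinearEquiv.apply_symm_apply, inner_neg_left]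
    have hdiff : DifferentiableAt ℝ (Hyperboloid.ballDefFn : EuclideanSpace ℝ (Fin 5) → ℝ)
        ((Set.inclusion Metric.sphere_subset_closedBall y :
          ↥(Metric.closedBall (0 : EuclideanSpace ℝ (Fin 5)) 1)) : EuclideanSpace ℝ (Fin 5)) :=
      (Hyperboloid.hasFDerivAt_ballDefFn _).differentiableAt
    have hmf := mfderiv_comp_coe_closedBall (F := ℝ)
      (g := (Hyperboloid.ballDefFn : EuclideanSpace ℝ (Fin 5) → ℝ))
      (Set.inclusion Metric.sphere_subset_closedBall y) hdiff
    rw [show mfderiv (𝓡∂ 5) 𝓘(ℝ, ℝ)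
        (fun x : ↥(Metric.closedBall (0 : EuclideanSpace ℝ (Fin 5)) 1) =>
          Hyperboloid.ballDefFn (x : EuclideanSpace ℝ (Fin 5)))
        (Set.inclusion Metric.sphere_subset_closedBall y) v =
        ((fderiv ℝ (Hyperboloid.ballDefFn : EuclideanSpace ℝ (Fin 5) → ℝ)
          ((Set.inclusion Metric.sphere_subset_closedBall y :
            ↥(Metric.closedBall (0 : EuclideanSpace ℝ (Fin 5)) 1)) : EuclideanSpace ℝ (Fin 5))).comp
          (closedBallCoeDeriv (Set.inclusion Metric.sphere_subset_closedBall y) :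
            EuclideanSpace ℝ (Fin 5) →L[ℝ] EuclideanSpace ℝ (Fin 5))) v from
      DFunLike.congr_fun hmf v]
    rw [ContinuousLinearMap.comp_apply, (Hyperboloid.hasFDerivAt_ballDefFn _).fderiv,
      _root_.neg_apply, Hyperboloid.dot_apply]
    rfl

end Summit.SmoothPoincare4.SmoothPoincare4.Cruxes.PEFillNearRound.RoundFilled

end
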